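import Summits.BirchSwinnertonDyer.BirchSwinnertonDyer.Theorems.ManinLocalTwoThreeManinPrimeToAdditiveFiveLeDegreeUpSevenOfOrdinaryTwistLaw
import HarnessLib

/-!
# Route `ManinLocalTwoThree`, residual crux C5 `ManinPrimeToAdditiveFiveLe`
# (stmt-BirchSwinnertonDyer-22969), line `upper_anchor` (skeleton v9, sha 15e8acc5ed72):
# **the v8 anchor's cell ledger BY NAME — four Manin cells and the cell's conjecture E-imc-9(7)**

Width seat bsd-line-ml23-c5-p1-w4 (gen 0), piece ο2 (sequel of ο,
`…DegreeUpSevenOfOrdinaryTwistLaw.lean`: DEGREE-UP(7; II) ⟸ `OrdinaryRamifiedTwistLaw 7`). The lead's gen-5 finest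
cell table (p626637 `coreRED57unstarredOffII5_of_cells_of_anchorIVstarSeven_of_degreeUpIISeven`) reads
  v8 anchor `stub_red57unstarredOffIIAtFive` ⟸ SS57 ∧ ORD7 ∧ CORNER(5; III) ∧ ANCHOR(7; IV*) ∧ DEGREE-UP(7; II);
feeding its last hypothesis with ο gives

* `coreRED57unstarredOffII5_of_cells_of_anchorIVstarSeven_of_ordinaryRamifiedTwistLaw` — **v8 anchor (VERBATIM)
  ⟸ SS57 ∧ ORD7 ∧ CORNER(5; III) ∧ ANCHOR(7; IV*) ∧ `OrdinaryRamifiedTwistLaw 7`**: every hypothesis is now either a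
  pure Manin statement on ONE Raynaud cell of the `W[p]`-reducible residue at `p ∈ {5, 7}` — SS57 = (5; IV) ∪ (7; III)
  (potentially supersingular, `e ∈ {3, 4} < p − 1`), ORD7 = (7; IV) (potentially ordinary, `e = 3`), CORNER (5; III)
  (`e = 4 = p − 1`), ANCHOR (7; IV*) (starred, `e = 3`) — or the imc cell's registered, refuter-vetted `@[conjecture]`
  E-imc-9 read at `p = 7`. No degree / optimality law private to the line remains in the anchor.

With -w2's υ (p626338: U = E-imc-5(5) ∧ E-imc-5(7) + GK) and υ2 (p626766: DEG13 = E-imc-9(13)) the residual of C5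
along `upper_anchor` is {SS57, ORD7, CORNER(5;III), ANCHOR(7;IV*)} ∪ {E-imc-5(5), E-imc-5(7), E-imc-9(7), E-imc-9(13),
KP57 = stmt-23810, the cite-only prints incl. GK}. HONEST STATUS: conditional-result helper (`--supports … --as
helper`) between OPEN statements; nothing here proves BSD, Manin's conjecture, E-imc-9, the anchor stub or C5.

References: [EdixhovenManin1991] Thm. 3, Props. 7–9, §4; [DokchitserDokchitser2015LocalInvariants] Thm. 3.2, Thm. 7 /
Cor. 8; [SilvermanATAEC1994] IV Table 4.1; [KostersPannekoek2017] Thm. 1; [ZagierCMB1985] §1; [Watkins2002] §2.1;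
cell bsd-f2-manin MEMO-imc.md §10 (E-imc-9), `Cruxes/ManinPrimeToAdditiveFiveLe/LEDGER-upper-anchor.md` (gen 5).
-/

set_option autoImplicit false
-- the Theorems namespace of this sub repeats the summit name by design (D-0017 nested layout)
set_option linter.dupNamespace false

noncomputable section

open scoped Classical NumberField

namespace Summit.BirchSwinnertonDyer.BirchSwinnertonDyer.Theorems

open WeierstrassCurve IsDedekindDomain IsDedekindDomain.HeightOneSpectrum Rat.HeightOneSpectrum NumberField
  Literature.NumberTheory.EllipticCurves Literature.NumberTheory.EllipticCurves.ModularForms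
  Literature.NumberTheory.EllipticCurves.Rank1Residual
  Literature.NumberTheory.DiophantineGeometry
  Summit.BirchSwinnertonDyer.Rank1Residual.ManinAdditive
  Summit.BirchSwinnertonDyer.Rank1Residual.Additive

/-- **v8 anchor `stub_red57unstarredOffIIAtFive` (VERBATIM as the conclusion) ⟸ SS57 (`hSS`) ∧ ORD7 (`hORD`) ∧
CORNER(5; III) (`hC5III`) ∧ ANCHOR(7; IV*) (`hS`) ∧ E-imc-9 `OrdinaryRamifiedTwistLaw 7` (`hO`)** — the lead's p626637
with its degree-law hypothesis DEGREE-UP(7; II) supplied by ο (`degreeUpIISeven_of_ordinaryRamifiedTwistLaw`: the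
(7; II) cell is potentially good ORDINARY by the tree dictionary, so E-imc-9(7) applies). The four remaining
hypotheses are pure Manin statements on single Raynaud cells; `hO` is an OPEN conjecture of the cell. Conditional
result; nothing here proves C5. [cite: EdixhovenManin1991, Thm. 3 and §4]
[cite: DokchitserDokchitser2015LocalInvariants, Thm. 3.2] [cite: SilvermanATAEC1994, IV Table 4.1] -/
theorem coreRED57unstarredOffII5_of_cells_of_anchorIVstarSeven_of_ordinaryRamifiedTwistLaw
    (hSS : mazur_not_dvd_maninConstant_of_odd → abbesUllmo_not_dvd_maninConstant_of_not_dvd_level →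
      cesnavicius_not_two_dvd_maninConstant_of_two_dvd_level → exists_isNewformOf →
      ∀ (W : WeierstrassCurve ℚ) [W.IsElliptic] [W.IsGloballyMinimal] [NeZero (W.conductorNorm ℤ)]
        (D : ModularParametrizationData W (W.conductorNorm ℤ)),
        IsLatticeOptimal D → ∀ (p : ℕ) (hp : p.Prime), (p = 5 ∨ p = 7) → p ^ 2 ∣ W.conductorNorm ℤ →
        ¬ (∃ (W' : WeierstrassCurve ℚ) (q : ℕ), W'.IsElliptic ∧ W'.IsGloballyMinimal ∧ q.Prime ∧
            q ≠ 2 ∧ q ^ 2 ∣ W.conductorNorm ℤ ∧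
            IsIsogenous W (W'.quadraticTwist (((-1 : ℤ) ^ (q / 2) * q : ℤ) : ℚ)) ∧
            ¬ q ^ 2 ∣ W'.conductorNorm ℤ) →
        ¬ (∃ (W' : WeierstrassCurve ℚ) (d : ℤ), W'.IsElliptic ∧ W'.IsGloballyMinimal ∧
            (d = -1 ∨ d = 2 ∨ d = -2) ∧ 2 ^ 2 ∣ W.conductorNorm ℤ ∧
            IsIsogenous W (W'.quadraticTwist (d : ℚ)) ∧ ¬ 2 ^ 2 ∣ W'.conductorNorm ℤ) →
        ¬ W.HasIrreducibleModPGaloisRep p →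
        500000 < W.conductorNorm ℤ →
        p ∣ D.modularDegree →
        (∀ n : ℕ, W.kodairaSymbolAt ((Rat.HeightOneSpectrum.primesEquiv (R := ℤ)).symm ⟨p, hp⟩) ≠
          .Istar n) →
        padicValInt p W.minimalDiscriminantInt ≤ 4 →
        (p = 5 → padicValInt p W.minimalDiscriminantInt ≠ 2) →
        ((p = 5 ∧ padicValInt p W.minimalDiscriminantInt = 4) ∨
          (p = 7 ∧ padicValInt p W.minimalDiscriminantInt = 3)) →
        ¬ (p : ℤ) ∣ D.maninConstant)
    (hORD : mazur_not_dvd_maninConstant_of_odd → abbesUllmo_not_dvd_maninConstant_of_not_dvd_level →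
      cesnavicius_not_two_dvd_maninConstant_of_two_dvd_level → exists_isNewformOf →
      ∀ (W : WeierstrassCurve ℚ) [W.IsElliptic] [W.IsGloballyMinimal] [NeZero (W.conductorNorm ℤ)]
        (D : ModularParametrizationData W (W.conductorNorm ℤ)),
        IsLatticeOptimal D → ∀ (p : ℕ) (hp : p.Prime), (p = 5 ∨ p = 7) → p ^ 2 ∣ W.conductorNorm ℤ →
        ¬ (∃ (W' : WeierstrassCurve ℚ) (q : ℕ), W'.IsElliptic ∧ W'.IsGloballyMinimal ∧ q.Prime ∧
            q ≠ 2 ∧ q ^ 2 ∣ W.conductorNorm ℤ ∧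
            IsIsogenous W (W'.quadraticTwist (((-1 : ℤ) ^ (q / 2) * q : ℤ) : ℚ)) ∧
            ¬ q ^ 2 ∣ W'.conductorNorm ℤ) →
        ¬ (∃ (W' : WeierstrassCurve ℚ) (d : ℤ), W'.IsElliptic ∧ W'.IsGloballyMinimal ∧
            (d = -1 ∨ d = 2 ∨ d = -2) ∧ 2 ^ 2 ∣ W.conductorNorm ℤ ∧
            IsIsogenous W (W'.quadraticTwist (d : ℚ)) ∧ ¬ 2 ^ 2 ∣ W'.conductorNorm ℤ) →
        ¬ W.HasIrreducibleModPGaloisRep p →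
        500000 < W.conductorNorm ℤ →
        p ∣ D.modularDegree →
        (∀ n : ℕ, W.kodairaSymbolAt ((Rat.HeightOneSpectrum.primesEquiv (R := ℤ)).symm ⟨p, hp⟩) ≠
          .Istar n) →
        padicValInt p W.minimalDiscriminantInt ≤ 4 →
        (p = 5 → padicValInt p W.minimalDiscriminantInt ≠ 2) →
        p = 7 → padicValInt p W.minimalDiscriminantInt = 4 →
        ¬ (p : ℤ) ∣ D.maninConstant)
    (hC5III : mazur_not_dvd_maninConstant_of_odd → abbesUllmo_not_dvd_maninConstant_of_not_dvd_level →
      cesnavicius_not_two_dvd_maninConstant_of_two_dvd_level → exists_isNewformOf →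
      ∀ (W : WeierstrassCurve ℚ) [W.IsElliptic] [W.IsGloballyMinimal] [NeZero (W.conductorNorm ℤ)]
        (D : ModularParametrizationData W (W.conductorNorm ℤ)),
        IsLatticeOptimal D → ∀ (p : ℕ) (hp : p.Prime), (p = 5 ∨ p = 7) → p ^ 2 ∣ W.conductorNorm ℤ →
        ¬ (∃ (W' : WeierstrassCurve ℚ) (q : ℕ), W'.IsElliptic ∧ W'.IsGloballyMinimal ∧ q.Prime ∧
            q ≠ 2 ∧ q ^ 2 ∣ W.conductorNorm ℤ ∧
            IsIsogenous W (W'.quadraticTwist (((-1 : ℤ) ^ (q / 2) * q : ℤ) : ℚ)) ∧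
            ¬ q ^ 2 ∣ W'.conductorNorm ℤ) →
        ¬ (∃ (W' : WeierstrassCurve ℚ) (d : ℤ), W'.IsElliptic ∧ W'.IsGloballyMinimal ∧
            (d = -1 ∨ d = 2 ∨ d = -2) ∧ 2 ^ 2 ∣ W.conductorNorm ℤ ∧
            IsIsogenous W (W'.quadraticTwist (d : ℚ)) ∧ ¬ 2 ^ 2 ∣ W'.conductorNorm ℤ) →
        ¬ W.HasIrreducibleModPGaloisRep p →
        500000 < W.conductorNorm ℤ →
        p ∣ D.modularDegree →
        (∀ n : ℕ, W.kodairaSymbolAt ((Rat.HeightOneSpectrum.primesEquiv (R := ℤ)).symm ⟨p, hp⟩) ≠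
          .Istar n) →
        padicValInt p W.minimalDiscriminantInt ≤ 4 →
        (p = 5 → padicValInt p W.minimalDiscriminantInt ≠ 2) →
        p = 5 → padicValInt p W.minimalDiscriminantInt = 3 →
        ¬ (p : ℤ) ∣ D.maninConstant)
    (hS : mazur_not_dvd_maninConstant_of_odd → abbesUllmo_not_dvd_maninConstant_of_not_dvd_level →
      cesnavicius_not_two_dvd_maninConstant_of_two_dvd_level → exists_isNewformOf →
      ∀ (W : WeierstrassCurve ℚ) [W.IsElliptic] [W.IsGloballyMinimal] [NeZero (W.conductorNorm ℤ)]
        (D : ModularParametrizationData W (W.conductorNorm ℤ)),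
        IsLatticeOptimal D → ∀ (p : ℕ) (hp : p.Prime), (p = 5 ∨ p = 7) → p ^ 2 ∣ W.conductorNorm ℤ →
        ¬ (∃ (W' : WeierstrassCurve ℚ) (q : ℕ), W'.IsElliptic ∧ W'.IsGloballyMinimal ∧ q.Prime ∧
            q ≠ 2 ∧ q ^ 2 ∣ W.conductorNorm ℤ ∧
            IsIsogenous W (W'.quadraticTwist (((-1 : ℤ) ^ (q / 2) * q : ℤ) : ℚ)) ∧
            ¬ q ^ 2 ∣ W'.conductorNorm ℤ) →
        ¬ (∃ (W' : WeierstrassCurve ℚ) (d : ℤ), W'.IsElliptic ∧ W'.IsGloballyMinimal ∧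
            (d = -1 ∨ d = 2 ∨ d = -2) ∧ 2 ^ 2 ∣ W.conductorNorm ℤ ∧
            IsIsogenous W (W'.quadraticTwist (d : ℚ)) ∧ ¬ 2 ^ 2 ∣ W'.conductorNorm ℤ) →
        ¬ W.HasIrreducibleModPGaloisRep p →
        500000 < W.conductorNorm ℤ →
        p ∣ D.modularDegree →
        (∀ n : ℕ, W.kodairaSymbolAt ((Rat.HeightOneSpectrum.primesEquiv (R := ℤ)).symm ⟨p, hp⟩) ≠
          .Istar n) →
        p = 7 → padicValInt p W.minimalDiscriminantInt = 8 →
        ¬ (p : ℤ) ∣ D.maninConstant)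
    (hO : OrdinaryRamifiedTwistLaw 7) :
    mazur_not_dvd_maninConstant_of_odd → abbesUllmo_not_dvd_maninConstant_of_not_dvd_level →
    cesnavicius_not_two_dvd_maninConstant_of_two_dvd_level → exists_isNewformOf →
    ∀ (W : WeierstrassCurve ℚ) [W.IsElliptic] [W.IsGloballyMinimal] [NeZero (W.conductorNorm ℤ)]
      (D : ModularParametrizationData W (W.conductorNorm ℤ)),
      IsLatticeOptimal D → ∀ (p : ℕ) (hp : p.Prime), (p = 5 ∨ p = 7) → p ^ 2 ∣ W.conductorNorm ℤ →
      ¬ (∃ (W' : WeierstrassCurve ℚ) (q : ℕ), W'.IsElliptic ∧ W'.IsGloballyMinimal ∧ q.Prime ∧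
          q ≠ 2 ∧ q ^ 2 ∣ W.conductorNorm ℤ ∧
          IsIsogenous W (W'.quadraticTwist (((-1 : ℤ) ^ (q / 2) * q : ℤ) : ℚ)) ∧
          ¬ q ^ 2 ∣ W'.conductorNorm ℤ) →
      ¬ (∃ (W' : WeierstrassCurve ℚ) (d : ℤ), W'.IsElliptic ∧ W'.IsGloballyMinimal ∧
          (d = -1 ∨ d = 2 ∨ d = -2) ∧ 2 ^ 2 ∣ W.conductorNorm ℤ ∧
          IsIsogenous W (W'.quadraticTwist (d : ℚ)) ∧ ¬ 2 ^ 2 ∣ W'.conductorNorm ℤ) →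
      ¬ W.HasIrreducibleModPGaloisRep p →
      500000 < W.conductorNorm ℤ →
      p ∣ D.modularDegree →
      (∀ n : ℕ, W.kodairaSymbolAt ((Rat.HeightOneSpectrum.primesEquiv (R := ℤ)).symm ⟨p, hp⟩) ≠
        .Istar n) →
      padicValInt p W.minimalDiscriminantInt ≤ 4 →
      (p = 5 → padicValInt p W.minimalDiscriminantInt ≠ 2) →
      ¬ (p : ℤ) ∣ D.maninConstant :=
  coreRED57unstarredOffII5_of_cells_of_anchorIVstarSeven_of_degreeUpIISeven hSS hORD hC5III hS
    (degreeUpIISeven_of_ordinaryRamifiedTwistLaw hO)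

end Summit.BirchSwinnertonDyer.BirchSwinnertonDyer.Theorems

end
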